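import Literature.MathematicalPhysics.QuantumLattice.HubbardOpenBoxWeightedClusterSums
import Literature.MathematicalPhysics.QuantumLattice.HubbardOpenBoxTPPClusterOracle
import Literature.MathematicalPhysics.QuantumLattice.HubbardTPPWeightedClusterFloorInfVol
import HarnessLib

/-!
# The coded cluster oracle of the WEIGHTED open `t–t'–t''` cluster (weighted Anderson floors of object M, exact in `t''`)

Topic `MathematicalPhysics/QuantumLattice`, family `hubbard`. The instance of the generic data-free floor chain
(`HubbardOpenBoxCodedClusterRows` / `…Certificate` / `…CertificateBlocks`) for the weighted `t–t'–t''` cluster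
`hubbardOpenBoxTT'T''W r c τ υ ν a = hubbardOpenBoxTT'W r c τ υ ν + hamiltonian (rectBoxAxial2Graph r c) a 0`
(`HubbardTPPWeightedOpenBox`, hubbard-box-p3) with rational tables `τ = W(rk ·)(rk ·)/Q`, `υ = V(rk ·)/Q`, `ν = M(rk ·)/Q`,
`a = A/Q`; its floor tables at `a = t''/2` are the hypothesis `hF` of the weighted infinite-volume Anderson bound for
object M, `InfVolFermionState.tiGroundEnergyDensityAt_tpp_ge_of_boxFloorsW_2x3` (exact in `t''`).

* §1 coded entries `hzIntW₃ = hzIntW − A·openBoxHop(ax2)` (dictionary, symmetry, bound), the ORACLE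
  **`weightedTppCluster a b W V M A`** (`app` = weighted application − `A·` axial list sum), its vector dictionary,
  spin-exchange invariance / sector preservation of the weighted `t–t'–t''` cluster, **`weightedTppCluster_models`**,
  **`groundEnergy_ge_of_kCertsWT₃`**;
* §2 the packaged form **`tiGroundEnergyDensityAt_tpp_ge_of_weightedTppKCerts_2x3`**: kernel table + the integer
  bookkeeping identities (`decide`) ⇒ `2m − 12μρ ≤ e^M(t, t', t'', U; ρ)`.

Everything is proved; no named fact; nothing numerical is asserted here.

## References

* R. Valentí, J. Stolze, P. J. Hirschfeld, Phys. Rev. B 43 (1991) 13743, §II. [cite: ValentiStolzeHirschfeld1991, §II]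
* E. Pavarini et al., PRL 87 (2001) 047003, eq. (1). [cite: PavariniEtAl2001, eq. (1)]
* H. Q. Lin, J. E. Gubernatis, Comput. Phys. 7 (1993) 400, §II. [cite: LinGubernatis1993, §II]
* I. Kull, N. Schuch, B. Dive, M. Navascués, PRX 14 (2024) 021008, §5.3. [cite: KullEtAl2024, §5.3]
-/

noncomputable section

namespace Literature.MathematicalPhysics.QuantumLattice

namespace OccupationCode

open Finset Matrix HubbardWave0 ClusterLowerBound ThermodynamicLimit Literature.Computation.Certificates

/-! ### §1 The weighted `t–t'–t''` oracle -/

/-- **Coded entries of the weighted `t–t'–t''` cluster**: `hzIntW₃ = hzIntW − A·openBoxHop(axial-2 bonds)`.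
[cite: LinGubernatis1993, §II] [cite: PavariniEtAl2001, eq. (1)] -/
def hzIntW₃ (a b : ℕ) (W : ℕ → ℕ → ℤ) (V M : ℕ → ℤ) (A : ℤ) (m m' : ℕ) : ℤ :=
  hzIntW a b W V M m m' - A * openBoxHop (ax2AdjCode b) (a * b) m m'

/-- The a-priori bound `|hzIntW₃| ≤ hzBoundW + |A|·2(ab)²`. [cite: LinGubernatis1993, §II] -/
def hzBoundW₃ (N : ℕ) (W : ℕ → ℕ → ℤ) (V M : ℕ → ℤ) (A : ℤ) : ℕ :=
  hzBoundW N W V M + A.natAbs * (2 * N * N)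

/-- **THE ORACLE of the weighted `t–t'–t''` cluster** `Q·h^{W}_{a×b}(W/Q, V/Q, M/Q; A/Q)`: the weighted application minus
`A·` the axial range-2 adjacency-list sum; bound `hzBoundW₃`. [cite: LinGubernatis1993, §II] [cite: PavariniEtAl2001, eq. (1)] -/
def weightedTppCluster (a b : ℕ) (W : ℕ → ℕ → ℤ) (V M : ℕ → ℤ) (A : ℤ) : CodedCluster where
  app m f := (weightedCluster a b W V M).app m f - A * hopListSum m f (hopOrbs (ax2AdjCode b) (a * b))
  bound := hzBoundW₃ (a * b) W V M A

section Box

variable {a b : ℕ}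

/-- **Entry dictionary (rational tables)**: `h^{W,tt't''}(W/Q, V/Q, M/Q; A/Q) s s' = hzIntW₃ (code s) (code s') / Q`.
[cite: LinGubernatis1993, §II] -/
theorem hubbardOpenBoxTT'T''W_apply_eq_hzIntW₃_div (W : ℕ → ℕ → ℤ) (V M : ℕ → ℤ) (A : ℤ) (Q : ℕ)
    (s s' : Finset (Orb (Fin a ×ₗ Fin b))) :
    hubbardOpenBoxTT'T''W a b (fun x y => (W (siteRank x) (siteRank y) : ℝ) / Q) (fun x => (V (siteRank x) : ℝ) / Q)
        (fun x => (M (siteRank x) : ℝ) / Q) ((A : ℝ) / Q) s s' =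
      ((hzIntW₃ a b W V M A (code s) (code s') : ℝ) : ℂ) / ((Q : ℝ) : ℂ) := by
  rw [hubbardOpenBoxTT'T''W_def, Matrix.add_apply, hubbardOpenBoxTT'W_apply_eq_hzIntW_div, hamiltonian_apply,
    sum_hop_eq_openBoxHop _ (ax2AdjCode b) ax2AdjCode_siteRank, hzIntW₃]
  push_cast
  ring

/-- **Symmetry** of the coded entries on configurations (symmetric `W`). [cite: LinGubernatis1993, §II] -/
theorem hzIntW₃_code_symm (W : ℕ → ℕ → ℤ) (hW : ∀ P Q, W P Q = W Q P) (V M : ℕ → ℤ) (A : ℤ)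
    (s s' : Finset (Orb (Fin a ×ₗ Fin b))) :
    hzIntW₃ a b W V M A (code s) (code s') = hzIntW₃ a b W V M A (code s') (code s) := by
  have hH := (hubbardOpenBoxTT'T''W_isHermitian (r := a) (c := b) (fun x y => (W (siteRank x) (siteRank y) : ℝ) / (1 : ℕ))
    (fun x y => by simp only [hW]) (fun x => (V (siteRank x) : ℝ) / (1 : ℕ)) (fun x => (M (siteRank x) : ℝ) / (1 : ℕ))
    ((A : ℝ) / (1 : ℕ))).apply s s'
  rw [hubbardOpenBoxTT'T''W_apply_eq_hzIntW₃_div, hubbardOpenBoxTT'T''W_apply_eq_hzIntW₃_div, Nat.cast_one,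
    Complex.ofReal_one, div_one, div_one, RCLike.star_def, Complex.conj_ofReal] at hH
  exact_mod_cast hH.symm

/-- **`|hzIntW₃| ≤ hzBoundW₃`.** [cite: LinGubernatis1993, §II] -/
theorem abs_hzIntW₃_le (W : ℕ → ℕ → ℤ) (V M : ℕ → ℤ) (A : ℤ) (m m' : ℕ) :
    |hzIntW₃ a b W V M A m m'| ≤ (hzBoundW₃ (a * b) W V M A : ℤ) := by
  unfold hzIntW₃ hzBoundW₃
  have h1 := abs_hzIntW_le (a := a) (b := b) W V M m m'
  have h2 : |A * openBoxHop (ax2AdjCode b) (a * b) m m'| ≤ |A| * ((a * b : ℕ) * ((a * b : ℕ) * 2)) := by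
    have h := abs_hzInt₃_le (a := a) (b := b) 0 0 A 0 m m'
    simp only [hzInt₃, hzInt, hzBound₃, hzBound, zero_mul, neg_zero, sub_zero, add_zero, zero_add, Int.natAbs_zero,
      zero_sub, abs_neg, Nat.cast_mul] at h
    rw [abs_mul]
    calc |A| * |openBoxHop (ax2AdjCode b) (a * b) m m'| = |A * openBoxHop (ax2AdjCode b) (a * b) m m'| := (abs_mul _ _).symm
      _ ≤ _ := h
      _ = |A| * ((a * b : ℕ) * ((a * b : ℕ) * 2)) := by rw [Int.natCast_natAbs]; push_cast; ring
  refine (abs_sub _ _).trans ?_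
  push_cast at h2 ⊢
  linarith

/-- **The weighted `t–t'–t''` cluster on a coded vector** (rational tables): `(h φ_f)(s) = app (code s) f / Q`.
[cite: LinGubernatis1993, §II] -/
theorem hubbardOpenBoxTT'T''W_mulVec_code_div (W : ℕ → ℕ → ℤ) (V M : ℕ → ℤ) (A : ℤ) (Q : ℕ) (f : ℕ → ℤ)
    (s : Finset (Orb (Fin a ×ₗ Fin b))) :
    (hubbardOpenBoxTT'T''W a b (fun x y => (W (siteRank x) (siteRank y) : ℝ) / Q) (fun x => (V (siteRank x) : ℝ) / Q)
        (fun x => (M (siteRank x) : ℝ) / Q) ((A : ℝ) / Q) *ᵥ codedVec f) s =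
      (((weightedTppCluster a b W V M A).app (code s) f : ℝ) : ℂ) / ((Q : ℝ) : ℂ) := by
  rw [hubbardOpenBoxTT'T''W_def, add_mulVec, Pi.add_apply, hubbardOpenBoxTT'W_mulVec_code_div, hamiltonian_hop_smul,
    Matrix.smul_mulVec, Pi.smul_apply, axial2_hamiltonian_mulVec_codedVec, smul_eq_mul]
  show _ = (((((weightedCluster a b W V M).app (code s) f - A * hopListSum (code s) f (hopOrbs (ax2AdjCode b) (a * b)) : ℤ)
    : ℤ) : ℝ) : ℂ) / ((Q : ℝ) : ℂ)
  rw [hopListSum_hopOrbs]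
  push_cast
  ring

/-- **The weighted `t–t'–t''` cluster is spin-exchange invariant.** [cite: LiebPRL1989, proof of Theorem 1] -/
theorem relabel_spinSwap_hubbardOpenBoxTT'T''W (τ : Fin a ×ₗ Fin b → Fin a ×ₗ Fin b → ℝ) (υ ν : Fin a ×ₗ Fin b → ℝ) (c : ℝ) :
    relabel (Orb.spinSwap : Orb (Fin a ×ₗ Fin b) ≃ Orb (Fin a ×ₗ Fin b)) (hubbardOpenBoxTT'T''W a b τ υ ν c) =
      hubbardOpenBoxTT'T''W a b τ υ ν c := by
  rw [hubbardOpenBoxTT'T''W_def, map_add, relabel_spinSwap_hubbardOpenBoxTT'W, relabel_spinSwap_hamiltonian]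

/-- **The weighted `t–t'–t''` cluster preserves the spin sectors.** [cite: LiebPRL1989, proof of Theorem 1] -/
theorem preservesSectors_hubbardOpenBoxTT'T''W (τ : Fin a ×ₗ Fin b → Fin a ×ₗ Fin b → ℝ) (υ ν : Fin a ×ₗ Fin b → ℝ) (c : ℝ) :
    PreservesSectors (hubbardOpenBoxTT'T''W a b τ υ ν c) := by
  rw [hubbardOpenBoxTT'T''W_def]
  exact (preservesSectors_hubbardOpenBoxTT'W τ υ ν).add (LiebThm1.preservesSectors_hamiltonian _ _ _)

/-- **SEMANTICS OF THE WEIGHTED `t–t'–t''` ORACLE** (symmetric `W`, any `Q`). [cite: LinGubernatis1993, §II] [cite: PavariniEtAl2001, eq. (1)] -/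
theorem weightedTppCluster_models (W : ℕ → ℕ → ℤ) (hW : ∀ P Q, W P Q = W Q P) (V M : ℕ → ℤ) (A : ℤ) (Q : ℕ) :
    (weightedTppCluster a b W V M A).Models a b (hzIntW₃ a b W V M A) Q
      (hubbardOpenBoxTT'T''W a b (fun x y => (W (siteRank x) (siteRank y) : ℝ) / Q) (fun x => (V (siteRank x) : ℝ) / Q)
        (fun x => (M (siteRank x) : ℝ) / Q) ((A : ℝ) / Q)) where
  apply_eq s s' := hubbardOpenBoxTT'T''W_apply_eq_hzIntW₃_div W V M A Q s s'
  mulVec_eq f s := hubbardOpenBoxTT'T''W_mulVec_code_div W V M A Q f s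
  preserves := preservesSectors_hubbardOpenBoxTT'T''W _ _ _ _
  symm s s' := hzIntW₃_code_symm W hW V M A s s'
  abs_le m m' := abs_hzIntW₃_le W V M A m m'

end Box

/-- **Certificate form for the weighted `t–t'–t''` cluster (sectors `p ≤ q`, checks in pieces).**
[cite: KullEtAl2024, §5.3] [cite: ValentiStolzeHirschfeld1991, §II] -/
theorem groundEnergy_ge_of_kCertsWT₃ (a b : ℕ) (W : ℕ → ℕ → ℤ) (hW : ∀ P Q, W P Q = W Q P) (V M : ℕ → ℤ) (A : ℤ) (Q : ℕ)
    {k : ℕ} (hk : k ≤ 2 * (a * b)) (σ : ℚ) (Ls : ℕ → List ℕ) (certs : ℕ → KCert)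
    (hpass : ∀ p ≤ k, p ≤ k - p → (certs p).PassesG (weightedTppCluster a b W V M A) a b p (k - p) Q (Ls p))
    (hσ : ∀ p ≤ k, p ≤ k - p → σ ≤ (certs p).floor Q) :
    (σ : ℝ) ≤ groundEnergy (hubbardOpenBoxTT'T''W a b (fun x y => (W (siteRank x) (siteRank y) : ℝ) / Q)
      (fun x => (V (siteRank x) : ℝ) / Q) (fun x => (M (siteRank x) : ℝ) / Q) ((A : ℝ) / Q)) k :=
  groundEnergy_ge_of_kCertsG₃ (weightedTppCluster_models (a := a) (b := b) W hW V M A Q)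
    (relabel_spinSwap_hubbardOpenBoxTT'T''W _ _ _ _) hk σ Ls certs hpass hσ

/-! ### §2 The weighted `2 × 3` Anderson bound for object M from a kernel floor table -/

/-- **Weighted `2 × 3` Anderson bound for OBJECT M from kernel certificates (packaged form, exact in `t''`).** For integer
tables `W₀` (symmetrised by `symW`), `V`, `M`, axial weight `A` and `Q > 0`: a floor table
`σ k ≤ E₀(h^{W,tt't''}_{2×3}(symW W₀/Q, V/Q, M/Q; A/Q), k)` (`k ≤ 12`; e.g. `groundEnergy_ge_of_kCertsWT₃`), the integer identities
`wsumVCode + wsumHCode = t·Q`, `2·wsumD₁Code = t'·Q`, `2·wsumD₂Code = t'·Q`, `2·Σ V = U·Q`, `Σ M = 0`, `2·A = t''·Q`, and a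
supporting line `m ≤ σ k + μk` give `2m − 12μρ ≤ e^M(t, t', t'', U; ρ)` for `0 < ρ < 2`.
[cite: ValentiStolzeHirschfeld1991, §II] [cite: Anderson1951, eq. (2)] [cite: PavariniEtAl2001, eq. (1)] -/
theorem tiGroundEnergyDensityAt_tpp_ge_of_weightedTppKCerts_2x3 (W₀ : ℕ → ℕ → ℤ) (V M : ℕ → ℤ) (A : ℤ) {Q : ℕ} (hQ : 0 < Q)
    {σ : ℕ → ℝ} {t t' t'' U : ℝ}
    (hF : ∀ k ≤ 12, σ k ≤ groundEnergy (hubbardOpenBoxTT'T''W 2 3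
      (fun x y => (symW W₀ (siteRank x) (siteRank y) : ℝ) / Q) (fun x => (V (siteRank x) : ℝ) / Q)
      (fun x => (M (siteRank x) : ℝ) / Q) ((A : ℝ) / Q)) k)
    (ht : ((wsumVCode 3 6 (symW W₀) + wsumHCode 3 6 (symW W₀) : ℤ) : ℝ) = t * Q)
    (hd₁ : ((2 * wsumD₁Code 3 6 (symW W₀) : ℤ) : ℝ) = t' * Q) (hd₂ : ((2 * wsumD₂Code 3 6 (symW W₀) : ℤ) : ℝ) = t' * Q)
    (hU : ((2 * sumNat V 6 : ℤ) : ℝ) = U * Q) (hν : sumNat M 6 = 0) (hA : ((2 * A : ℤ) : ℝ) = t'' * Q)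
    (μ m : ℝ) (hm : ∀ k ≤ 12, m ≤ σ k + μ * k) {ρ : ℝ} (hρ0 : 0 < ρ) (hρ2 : ρ < 2) :
    2 * m - 12 * μ * ρ ≤ (hubbardTT'T''FermionInteraction t t' t'' U).tiGroundEnergyDensityAt 2 ρ := by
  have hQ' : (Q : ℝ) ≠ 0 := by exact_mod_cast hQ.ne'
  have hA' : (A : ℝ) / Q = t'' / 2 := by
    rw [div_eq_div_iff hQ' two_ne_zero]
    push_cast at hA
    linarith
  rw [hA'] at hF
  refine InfVolFermionState.tiGroundEnergyDensityAt_tpp_ge_of_boxFloorsW_2x3 (fun x y => by rw [symW_symm]) ?_ ?_ ?_ ?_ ?_ hF μ m hm hρ0 hρ2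
  · rw [wsumV_siteRank_div, wsumH_siteRank_div, ← add_div, div_eq_iff hQ']
    exact_mod_cast ht
  · rw [wsumD₁_siteRank_div, mul_div_assoc', div_eq_iff hQ']
    exact_mod_cast hd₁
  · rw [wsumD₂_siteRank_div, mul_div_assoc', div_eq_iff hQ']
    exact_mod_cast hd₂
  · rw [sum_siteRank_div, mul_div_assoc', div_eq_iff hQ']
    exact_mod_cast hU
  · rw [sum_siteRank_div, show (2 * 3 : ℕ) = 6 from rfl, hν]
    simp

end OccupationCode

end Literature.MathematicalPhysics.QuantumLattice
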